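import Summits.QuantumFields.YangMills.Theorems.BalabanUVNodesN27AtRecord13CoPHHolder
import Summits.QuantumFields.YangMills.Theorems.BalabanUVNodesN16OfEdgesAllTorusAtRecord13CoPH

/-!
# BalabanUVNodes ∕ N27 = binder B5 AT THE RECORD — THE READING STOREY AT NODE N16's CURRENCY OF RECORD «R-β» WITH THE N16 SLOT PRODUCED FROM ITS TWO IN-EDGES, LETTERS
# CHOSEN (dag-n16-e 37ᴴ `…N16OfEdgesAllTorusAtRecord13CoPH` §2 `exists_letters_s_N16Holder_readingOfRecord₁₃CoPHOn_of_edges_allTorus (hβ0 hβ1) (hg) (h5) (h7)`, p545649):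
# the EDGES twin of (Q) §3 `spine_rec13CCoPHOn_at_readingOfRecord₁₃CoPH_holder_of_thm33Letters` — node N05's UNPACKED LEAF (`B8.Thm4Body` ∕ `B8.Prop3Body` at exponent `β` on the pinned
# all-torus proper sub-index, constants + window) and node N07's linear leaf in place of node N06's Theorem 3.3 + dictionary + letters
# (cell `pub-ymgap`, HUMAN RULING D-0062 Track A; director-ym №197 ∕ HUMAN RULING D-0149 width seats; seat `pub-ymgap-dag-n17-w3` RELEASED to row N27 (W-a) «Edges first» by plan g78
# W-SEAT-START-LIST v4 d9b9e2ad1f27a837; K3⁷ `SpineGivenEndpointR13SepCoPH` = stmt-QuantumFields-20544, `--kind proof --supports 20544 --as helper`; COUNT-NEUTRAL; THEOREMS ONLY, 0 `def`,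
# 0 `sorry`; `N`-generic, regime-generic, NO Theses import — an item-facing face is ONE application of leaf A §4 at `Rg := Node00.unityNondeg₁₃H 2`, `N = 2`, as leaf E does for (Q) §3)

THE KIT PATTERN (plan v4 §n27: «slice the TREE parent, swap ONE producer face»).  PARENT = (Q) `…N27AtRecord13CoPHHolder` (dag-n27-c g10, p581033) §2 ★
`spine_rec13CCoPHOn_at_readingOfRecord₁₃CoPH_holder` (N27 = B5 at the regime record class from the stubs at the regime home of dag-n22-e's reading of record
`readingOfRecord₁₃CoPH w1 ℓ₃ ne2 ne1`, node N16's stub in the currency of record R-β `S_N16Holder β (RRec₁₃CoPHOn … Rg)`, N17 ELIMINATED by dag-n17-a `YMDAG.N17.s_N17_of_D4_N18`, the N19′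
edge reading dag-n16-e 41ᴴ's `RatesHolderAt … β`).  THE ONE FACE SWAPPED: (Q) §3 produces `h16` by dag-n16-e 40ᴮ §2 (node N06's `B9.Thm33Printed` + dag-n06-b's At-dictionary with the
Hölder binder at exponent `β` + the [4] letters + N07's leaf, binders `hg₃ hD h7`); HERE `h16` is produced by dag-n16-e 37ᴴ §2 `exists_letters_s_N16Holder_readingOfRecord₁₃CoPHOn_of_edges_allTorus`
from N16's TWO IN-EDGES AS THE TREE TYPES THEM — `hg` (a coupling letter `g F > 0`), `h5` (per family: node N05's unpacked leaf = a length letter `len`, constants `c₁ c₁' B₁' cP C₂ B₀β`,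
`inp : B8.B9Inputs`, the explicit small-constants window, `B8.Thm4Body c₁ B₁' (… zdGF3 (M_N ℂ) F.L β len i.1 …)` and `B8.Prop3Body cP 4 F.L C₂ inp B₀β (…)` on the PINNED all-torus proper
sub-index `{i : ZdIdx 4 F.L // (∀ j, i.Ω j = univ) ∧ (∀ m j, i.Λs m j = {y | j = m}) ∧ (∀ m j, i.Λb m j = {c | j = m}) ∧ i.η = (F.L⁻¹)^{i.k}}`) and `h7` (node N07's linear `LeafH3sup`) —
37ᴴ's binders VERBATIM as the theorem's leading binders, leaf E's display (`0 ≤ β ≤ 1`).  Since the Spine conclusion never mentions `ℓ₃`, the ONE binder that reads `ℓ₃` — the home-keyed N19′ edge `h19` — is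
asked FOR EVERY `ℓ₃` (dag-n19-d's edge faces are reading-generic), exactly as in (Q) §3.  EVERY OTHER BINDER AND THE CONCLUSION VERBATIM from (Q) §3; proof = `obtain ⟨ℓ₃, h16, -⟩ := 37ᴴ …`
then (Q) §2 at that `ℓ₃` with dag-n22-e's `s_N1x_rRec₁₃CoPHOn_iff` unfoldings.  (Q), 37ᴴ, 40ᴮ, leaf E and every landed declaration UNTOUCHED (additive file); nothing re-declared.

WHAT IS KERNEL-CHECKED ([bookkeeping]; 0 `def`, 0 `sorry`):
* §1 ★★ `spine_rec13CCoPHOn_at_readingOfRecord₁₃CoPH_holder_of_edges` — N27 = B5 at node00-def-RR-2's regime record class `IsRecordOfRecord₁₃CCoPHOn F N Rg` from: NE1′ on `ne1`, NE2 on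
  `ne2`, NE5 ∕ NE9 ∕ (D4) on the reading's `u3Objects` (guarded θ-form), N16 AT EXPONENT `β` ⟸ 37ᴴ from `hβ0 hβ1 hg h5 h7`, N17 eliminated, N20 ∕ N21 ∕ extraction displayed, the N19′ edge
  reading `RatesHolderAt … β` for every `ℓ₃`.

HONEST FRAMING.  COMPOSITE-node bookkeeping BY NAME; no estimate of its own.  Node N05's leaf bodies ([Balaban1985RegularSpaces] Thm 4 ∕ Prop 3 in the tree's `B8.Thm4Body` ∕ `B8.Prop3Body`
dress at exponent `β`), node N07's linear `LeafH3sup`, NE1′ ∕ NE2 ∕ NE5 ∕ NE9 ∕ (D4), NE7 ∕ NE7b ∕ NE7c and the extraction clause are HYPOTHESES asserted for no family (the children's open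
obligations; 0∕1 at the ₁₃ record today — K0⁷ OPEN, no `Provisos₁₃CoPH` inhabitant claimed); `β` a LETTER (`0 ≤ β ≤ 1` here; the consumers' window `2∕3 < β < 1` is theirs); NE3 at
exponent β NOT PROVED; nothing of Bałaban's asserted or instantiated; N05 ∕ N07 ∕ N16 ∕ N17 ∕ N27 NOT discharged; K3⁷ NOT claimed; counts UNMOVED (typed 28∕28 · discharged 5∕27, A 5∕28).
One finite four-torus programme at fixed `ε` per run — R4 closes the conditional rung `BalabanLadder.UV` only; NOT ℝ⁴, NOT infinite volume, NOT OS, NOT a mass gap, NOT Clay.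
No decl below carries a cite tag.
-/

set_option autoImplicit false

namespace Summit.QuantumFields.YangMills.Theorems.BalabanUVNodesN27SpineRecord

open scoped Matrix.Norms.L2Operator

open Literature.MathematicalPhysics.QuantumFieldTheory.Balaban1983to89
open Literature.MathematicalPhysics.QuantumFieldTheory.Balaban1983to89.T4Continuum
open T4ContinuumYM4Torus (ForSmallCouplings)
open Summit.QuantumFields.BalabanUV.T4Continuum.Spine
open YMDAG.UVSplit
open Node00 (Stage13HParams datumOfRecord₁₃CoPH IsRecordOfRecord₁₃CCoPH IsDatumOfRecord₁₃CCoPH NE3Letters₁₁ NE2Objects₁₁ ne3ConstLayerOfRecord₁₁ MatA)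
open Node00.W1 (ReadingData)
open T4WeightBudget (RelWeightBound)
open T4IndicatorShell (ShellWeightBound)
open B7Prop1Explicit B7Prop2Explicit
open B7Prop3Flat (c3)
open B8LeafModelZd (ZdIdx)
open B8LeafModelZd3 (zdGF3)
open Node00 (ne3NperOfRecord₁₁ ne3DomOfRecord₁₁)
open Summit.QuantumFields.BalabanUV.T4Continuum.NE3.LeafIndexSockets (LeafH3sup)
open Summit.QuantumFields.YangMills.BalabanUVNodes.N16HolderDefs (N16HolderAt S_N16Holder)
open Summit.QuantumFields.YangMills.BalabanUVNodes.SpineRatesHolder (RatesHolderAt)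
open Summit.QuantumFields.YangMills.BalabanUVNodes.N16OfEdgesAllTorusAtRecord13CoPH (exists_letters_s_N16Holder_readingOfRecord₁₃CoPHOn_of_edges_allTorus)

variable {N : ℕ} [NeZero N] (cr : SpineReading₁₃CoPH N)

/-! ## §1 The N16 slot AT EXPONENT `β` read off node N16's TWO IN-EDGES — N05's unpacked leaf at exponent `β` on the pinned all-torus proper sub-index + N07's linear leaf
(dag-n16-e 37ᴴ §2, letters produced; `0 ≤ β ≤ 1`) -/

section Edges

variable (w1 : (F : T4Family) → (θ : Stage13HParams F N) → Node00.W1.ReadingData F (Node00.MatA N) θ.τ9.M)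
  (ne2 : (F : T4Family) → Stage13HParams F N → (ℕ → ℝ) → List (ULoop F) → ℕ → NE2Objects₁₁)
  (ne1 : (F : T4Family) → Stage13HParams F N → (ℕ → ℝ) → List (ULoop F) → NE1pCarriers)

/-- ★★ **N27 = B5 AT THE REGIME RECORD CLASS FROM THE SLOTS AT THE REGIME HOME OF THE READING OF RECORD, THE N16 SLOT IN THE CURRENCY OF RECORD R-β READ OFF NODE N16's TWO
IN-EDGES — N05's UNPACKED LEAF AT EXPONENT `β` (conjuncts `B8.Thm4Body` ∕ `B8.Prop3Body` on the PINNED all-torus proper sub-index, constants and window) + N07's LINEAR LEAF, LETTERS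
PRODUCED** ((Q) §3 `spine_rec13CCoPHOn_at_readingOfRecord₁₃CoPH_holder_of_thm33Letters`'s EDGES twin: `h16` ⟸ dag-n16-e 37ᴴ §2
`exists_letters_s_N16Holder_readingOfRecord₁₃CoPHOn_of_edges_allTorus hβ0 hβ1 hg h5 h7`, the other rate slots in guarded θ-form (dag-n22-e `s_N1x_rRec₁₃CoPHOn_iff`), N17 eliminated
(dag-n17-a `YMDAG.N17.s_N17_of_D4_N18` inside (Q) §2), the N19′ edge reading dag-n16-e 41ᴴ's `RatesHolderAt … β` for every `ℓ₃`); at `Rg :=` the item's guard, `N = 2` THE ITEM follows by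
leaf A §4 as leaf E does for (Q) §3.  Every hypothesis 0∕1 today; NE3 at exponent β NOT PROVED; N05 ∕ N07 ∕ N16 ∕ N27 NOT discharged. [bookkeeping] -/
theorem spine_rec13CCoPHOn_at_readingOfRecord₁₃CoPH_holder_of_edges {β : ℝ} (hβ0 : 0 ≤ β) (hβ1 : β ≤ 1) {g : T4Family → ℝ} (hg : ∀ F, 0 < g F)
    (h5 : ∀ F : T4Family, letI : CStarAlgebra (Matrix (Fin N) (Fin N) ℂ) := {}
      ∃ (len : Site 4 → ℝ) (c₁ c₁' B₁' cP C₂ B₀β : ℝ) (inp : B8.B9Inputs),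
        (∀ v : Site 4, 0 < len v → 1 ≤ len v) ∧ (∀ μ : Fin 4, len (e μ) = 1) ∧ 0 < B₁' ∧ 5 * ((4 : ℕ) : ℝ) * F.L * inp.B₀ ≤ B₁' ∧ 0 < c₁' ∧
        (∀ α₀ α₁ : ℝ, 0 < α₀ → 0 < α₁ → α₀ + α₁ ≤ c₁' →
          α₀ + α₁ ≤ c₁ ∧ C0 4 * (2 * α₀) ≤ 1 / 3 ∧ 4 * α₀ ≤ c2' 4 F.L ∧ 16 * (B₁' * (α₀ + α₁)) ≤ 1 ∧
          Real.exp (4 * (800 * (((4 : ℕ) : ℝ) + 1) ^ 2 * (((4 : ℕ) : ℝ) + 4)) * α₀) * (1 + 8 * (131072 * (((4 : ℕ) : ℝ) + 1) ^ 2) * (B₁' * (α₀ + α₁))) ≤ 2 ∧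
          2 * (B₁' * (α₀ + α₁)) ≤ c3 4 F.L ∧ ((4 : ℕ) : ℝ) * F.L * α₁ ≤ 1 / 8 ∧ α₀ ≤ cP ∧ α₁ ≤ cP ∧ B₁' * (α₀ + α₁) ≤ cP ∧
          2 * (B₁' * (α₀ + α₁)) ^ 2 + 20 * ((4 : ℕ) : ℝ) * α₀ * (B₁' * (α₀ + α₁)) + 2 * C₂ * (B₁' * (α₀ + α₁)) ^ 2 ≤ α₀ + α₁) ∧
        B8.Thm4Body c₁ B₁' (fun i : {i : ZdIdx 4 F.L // (∀ j, i.Ω j = Set.univ) ∧ (∀ m j, i.Λs m j = {_y | j = m}) ∧ (∀ m j, i.Λb m j = {_c | j = m}) ∧ i.η = ((F.L : ℝ)⁻¹) ^ i.k} => (zdGF3 (Matrix (Fin N) (Fin N) ℂ) F.L β len i.1).toGFData) ∧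
        B8.Prop3Body cP 4 (F.L : ℝ) C₂ inp B₀β (fun i : {i : ZdIdx 4 F.L // (∀ j, i.Ω j = Set.univ) ∧ (∀ m j, i.Λs m j = {_y | j = m}) ∧ (∀ m j, i.Λb m j = {_c | j = m}) ∧ i.η = ((F.L : ℝ)⁻¹) ^ i.k} => (zdGF3 (Matrix (Fin N) (Fin N) ℂ) F.L β len i.1).toGFData2))
    (h7 : ∀ F : T4Family, ∃ C ε₀ : ℝ, 0 ≤ C ∧ 0 < ε₀ ∧ ∀ ε : ℝ, 0 < ε → ε ≤ ε₀ →
      LeafH3sup 4 F.L (ne3NperOfRecord₁₁ F 0 0) ε (C * ε) (C * ε) (ne3DomOfRecord₁₁ F N 0 0))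
    (Rg : (F : T4Family) → Stage13HParams F N → Prop)
    (h14 : ∀ (F : T4Family) (θ : Stage13HParams F N), θ.Provisos₁₃CoPH F N → Rg F θ → θ.Admissible F N → ∀ (g₀ : ℕ → ℝ) (os : List (ULoop F)),
      N14At (ne1 F θ g₀ os))
    (h15 : ∀ (F : T4Family) (θ : Stage13HParams F N), θ.Provisos₁₃CoPH F N → Rg F θ → θ.Admissible F N → ∀ (g₀ : ℕ → ℝ) (os : List (ULoop F)) (k : ℕ),
      N15At (ne2OfRecord₁₁ (ne2 F θ g₀ os k)))
    (h18 : ∀ (F : T4Family) (θ : Stage13HParams F N), θ.Provisos₁₃CoPH F N → Rg F θ → θ.Admissible F N → ∀ k : ℕ,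
      N18At (u3OfRecord₁₃ θ.toStage13Params ((w1 F θ).u3Objects θ.γ) k))
    (h22 : ∀ (F : T4Family) (θ : Stage13HParams F N), θ.Provisos₁₃CoPH F N → Rg F θ → θ.Admissible F N → ∀ k : ℕ,
      N22At (u3OfRecord₁₃ θ.toStage13Params ((w1 F θ).u3Objects θ.γ) k))
    (hD4 : ∀ (F : T4Family) (θ : Stage13HParams F N) (hP : θ.Provisos₁₃CoPH F N), Rg F θ → θ.Admissible F N → ∀ k : ℕ,
      ReadOutAt (datumOfRecord₁₃CoPH F N θ hP) (u3OfRecord₁₃ θ.toStage13Params ((w1 F θ).u3Objects θ.γ) k))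
    (h20 : S_N20 (SRec₁₃CoPHOn cr Rg)) (h21 : S_N21 (SRec₁₃CoPHOn cr Rg))
    (hx : ∀ (F : T4Family) (θ : Stage13HParams F N) (hP : θ.Provisos₁₃CoPH F N), Rg F θ → θ.Admissible F N →
      B16.EndStatementBPrinted (datumOfRecord₁₃CoPH F N θ hP).C → DagBinding.EndpointExistence (datumOfRecord₁₃CoPH F N θ hP).C.toB12 →
        ForSmallCouplings (datumOfRecord₁₃CoPH F N θ hP) fun g₀ => ∀ os : List (ULoop F),
          0 < (cr F θ hP g₀ os).l₀ ∧ 0 < (cr F θ hP g₀ os).vol ∧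
          (∀ (K : ℕ) (t : ℝ), |t| ≤ (cr F θ hP g₀ os).l₀ →
            T4GenFunBounds.schemeZ ((datumOfRecord₁₃CoPH F N θ hP).scheme g₀) os ((cr F θ hP g₀ os).K₀ + K) t =
              ∑ τ ∈ (cr F θ hP g₀ os).T K, (cr F θ hP g₀ os).A K t τ) ∧
          (∀ (K : ℕ) (t : ℝ), |t| ≤ (cr F θ hP g₀ os).l₀ →
            T4GenFunBounds.schemeZ ((datumOfRecord₁₃CoPH F N θ hP).scheme g₀) os ((cr F θ hP g₀ os).K₀ + K + 1) t =
              ∑ τ ∈ (cr F θ hP g₀ os).T K, (cr F θ hP g₀ os).B K t τ))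
    (h19 : ∀ (ℓ₃ : T4Family → NE3Letters₁₁) (F : T4Family) (θ : Stage13HParams F N) (hP : θ.Provisos₁₃CoPH F N), Rg F θ → θ.Admissible F N → ∀ (g₀ : ℕ → ℝ) (os : List (ULoop F)),
      (∀ k : ℕ, RatesHolderAt (datumOfRecord₁₃CoPH F N θ hP) (rateCarriersOfRecord₁₃CoPH (readingOfRecord₁₃CoPH w1 ℓ₃ ne2 ne1) F θ hP g₀ os k) β) → letI := (cr F θ hP g₀ os).dec
        ∃ δ : ℕ → ℝ, NE7.Core (cr F θ hP g₀ os).l₀ (cr F θ hP g₀ os).vol (cr F θ hP g₀ os).T (cr F θ hP g₀ os).Bad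
          (fun K t τ => (cr F θ hP g₀ os).A K t τ - (cr F θ hP g₀ os).shA K t τ) (fun K t τ => (cr F θ hP g₀ os).B K t τ - (cr F θ hP g₀ os).shB K t τ) δ ∧
          Summable δ) :
    Spine (N := N) fun F D w => Node00.IsRecordOfRecord₁₃CCoPHOn F N Rg D w := by
  obtain ⟨ℓ₃, h16, -⟩ :=
    exists_letters_s_N16Holder_readingOfRecord₁₃CoPHOn_of_edges_allTorus hβ0 hβ1 (Rg := Rg) (w1 := w1) (ne2 := ne2) (ne1 := ne1) hg h5 h7
  exact spine_rec13CCoPHOn_at_readingOfRecord₁₃CoPH_holder cr β w1 ne2 ne1 Rg ℓ₃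
    ((s_N14_rRec₁₃CoPHOn_iff _ Rg).mpr fun F θ hP hRg hθ g₀ os => h14 F θ hP hRg hθ g₀ os)
    ((s_N15_rRec₁₃CoPHOn_iff _ Rg).mpr fun F θ hP hRg hθ g₀ os k => h15 F θ hP hRg hθ g₀ os k) h16
    ((s_N18_rRec₁₃CoPHOn_iff _ Rg).mpr fun F θ hP hRg hθ _ _ k => h18 F θ hP hRg hθ k)
    ((s_N22_rRec₁₃CoPHOn_iff _ Rg).mpr fun F θ hP hRg hθ _ _ k => h22 F θ hP hRg hθ k)
    ((s_D4_rRec₁₃CoPHOn_iff _ Rg).mpr fun F θ hP hRg hθ _ _ k => hD4 F θ hP hRg hθ k) h20 h21 hx (h19 ℓ₃)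

end Edges

end Summit.QuantumFields.YangMills.Theorems.BalabanUVNodesN27SpineRecord
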